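import Summits.QuantumFields.YangMills.Theorems.DiagonalMirrorRPRWilsonDiagonalModelPinnedLetters
import Summits.QuantumFields.YangMills.Theorems.DiagonalMirrorRPRWilsonDiagonalModelPinnedTrace
import Summits.QuantumFields.YangMills.Theorems.DiagonalMirrorRPRTepidLetters
import Summits.QuantumFields.YangMills.Theorems.DiagonalMirrorRPROddLogGap

/-!
# Crux `WeakCouplingHypercubicLimitRP` (stmt-QuantumFields-27398) / aside `DiagonalMirrorRPR` (stmt-QuantumFields-10604), door B:
# the remaining letters READ ON THE PINNED MODEL `wilsonDiagonalTransferModel` (R1♮ `OddLogGap` as an eigenvalue statement; the `{R1♮, R2}`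
# and `{R1, R2♭}` doors instantiated; `DiagTepid` along sub-schemes)

Helper file (`--supports stmt-QuantumFields-27398 --as helper`) of the hand `hand-10604-wilsonDiagModel-3` g0, docket director-ym g24 O4 WORD 43 (2)(ii) /
43a (a) (one model of record for letters = `WilsonDiagonal.wilsonDiagonalTransferModel` ✓p830030; hand-2's pattern `oddTwistGap_transferModel_iff`
✓p830072; this file keeps ONLY what those files do not carry).  It closes nothing by itself.

* `negPad_le_iff'` — hand-2's `negPad_le_iff` with an index-dependent threshold (re-proved, 10 lines);
* ★ `oddLogGap_transferModel_iff` — R1♮ `OddLogGap (wilsonDiagonalTransferModel r sch hβ)` (`…OddLogGap`, ✓p830230) holds iff for some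
  `M_k` with `M_k / log side_k → ∞`, eventually in `k`, every NEGATIVE eigenvalue `κᵢ` of the eigen-package `slicePkgAt r sch hβ k` obeys
  `-κᵢ ≤ exp(−M_k/side_k) · top_k` — index by index, a bare inequality on the eigen-package;
* `oddTorusSwapPairingLiminf_of_transferModel_logGap` — the `{R1♮, R2}` door on the pinned model (`core_of_logGap`);
* `DiagTepid.restrict` — R2♭ along sub-schemes (the sibling of `DiagLukewarm.restrict`; re-homed from the retired p830023), and with it
  `oddTorusSwapPairingLiminf_subseq_of_transferModel_tepid` — the `{R1, R2♭}` letters on the pinned model give the D1′ socket on every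
  sub-scheme (restricted model, `growth_subseq_of_polyRenorm_of_ufbPlanes`).
* ★ `diagLukewarm_transferModel_iff`, `diagTepid_transferModel_iff` — R2 / R2♭ on the pinned model unfold to bounds on the normalised even power
  sums `Σ' i (κᵢ/top_k)^{2t}` of the eigen-package (`tsum_posPad_pow_add_tsum_negPad_pow`, `transferModel_heatTrace_eq`; the numerator is Wilson's
  twisted diagonal trace `Tr K_u^{2t}` by hand-2's `wilsonDiagonalTransferModel_evenTrace`, ✓`…PinnedTrace`);
* `EvenTraceFormula` (cards #110∕#121 currency predicate, binder form, `sliceZ` unfolded) and ★ `evenTraceFormula_transferModel` (O4 WORD 45 (2)).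

HONEST FRAMING: unfoldings and one-line doors; NO letter is proved; R1, R1♮, R2, R2♭, D1′, S6i, ⟨27398⟩ (0∕2) and the aside ⟨10604⟩ are OPEN;
nothing here bears on the summit; the Yang–Mills mass gap is NOT proved here or anywhere in the tree.  One `Prop`-valued predicate on a model binder (`EvenTraceFormula`, the cards' currency), no instance, no notation.
-/

set_option autoImplicit false

noncomputable section

open scoped BigOperators
open MeasureTheory Function Filter Topology
open Literature.MathematicalPhysics.QuantumLattice Literature.MathematicalPhysics.QuantumFieldTheory
open Summit.QuantumFields.YangMills.Cruxes.HypercubicLimit.CouplingResponse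
open Summit.QuantumFields.YangMills.Cruxes.DiagonalMirrorRPR.ParityBridgeColdTraces

namespace Summit.QuantumFields.YangMills.Cruxes.DiagonalMirrorRPR.SignTwistedDiagonalTrace

/-! ## §1 R1♮ on the pinned model -/

section LogGap

variable {G : Type} [Group G] [TopologicalSpace G] [IsTopologicalGroup G] [CompactSpace G] [MeasurableSpace G] [BorelSpace G]
  (r : LatticeRep G) (sch : SpeciesScheme (YMSpecies G))

omit [TopologicalSpace G] [IsTopologicalGroup G] [CompactSpace G] [MeasurableSpace G] [BorelSpace G] in
/-- Padded negative parts below non-negative thresholds: `(∀ j, negPad emb κ j ≤ c) ↔ ∀ i, κ i < 0 → -κ i ≤ c` (`0 ≤ c`, `emb` injective;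
hand-2's `negPad_le_iff`, restated for use under a `k`-dependent threshold). -/
theorem negPad_le_iff' {ι : Type} {emb : ι → ℕ} (he : Function.Injective emb) (κ : ι → ℝ) {c : ℝ} (hc : 0 ≤ c) :
    (∀ j, WilsonDiagonal.negPad emb κ j ≤ c) ↔ ∀ i, κ i < 0 → -κ i ≤ c :=
  WilsonDiagonal.negPad_le_iff he κ hc

/-- ★ **R1♮ on the pinned model = a super-logarithmic torus-scale sign gap of the transfer operator's spectrum.**
`OddLogGap (wilsonDiagonalTransferModel r sch hβ)` holds iff for some `M` with `M_k / log side_k → ∞`, eventually in `k`, every negative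
eigenvalue `κᵢ` of the eigen-package at `k` obeys `-κᵢ ≤ exp(−M_k/side_k) · top_k`. -/
theorem oddLogGap_transferModel_iff (hβ : ∀ k, 0 ≤ sch.β k) :
    OddLogGap (WilsonDiagonal.wilsonDiagonalTransferModel r sch hβ) ↔
      ∃ M : ℕ → ℝ, Tendsto (fun k => M k / Real.log (sch.side k)) atTop atTop ∧
        ∀ᶠ k in atTop, ∀ i : (WilsonDiagonal.slicePkgAt r sch hβ k).s, (WilsonDiagonal.slicePkgAt r sch hβ k).κ i < 0 →
          -(WilsonDiagonal.slicePkgAt r sch hβ k).κ i ≤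
            Real.exp (-(M k / sch.side k)) * (WilsonDiagonal.wilsonDiagonalTransferModel r sch hβ).top k := by
  have h3 := WilsonDiagonal.eventually_three_le_side sch
  have hkey : ∀ (M : ℕ → ℝ) (k : ℕ), 3 ≤ sch.side k →
      ((∀ j, (WilsonDiagonal.wilsonDiagonalTransferModel r sch hβ).sm k j ≤
          Real.exp (-(M k / sch.side k)) * (WilsonDiagonal.wilsonDiagonalTransferModel r sch hβ).top k) ↔
        ∀ i : (WilsonDiagonal.slicePkgAt r sch hβ k).s, (WilsonDiagonal.slicePkgAt r sch hβ k).κ i < 0 →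
          -(WilsonDiagonal.slicePkgAt r sch hβ k).κ i ≤
            Real.exp (-(M k / sch.side k)) * (WilsonDiagonal.wilsonDiagonalTransferModel r sch hβ).top k) := by
    intro M k hk
    rw [WilsonDiagonal.wilsonDiagonalTransferModel_sm r sch hβ k hk]
    exact negPad_le_iff' (WilsonDiagonal.slicePkgAt r sch hβ k).emb_injective _
      (mul_nonneg (Real.exp_pos _).le ((WilsonDiagonal.wilsonDiagonalTransferModel r sch hβ).top_pos k).le)
  unfold OddLogGap
  constructor
  · rintro ⟨M, hM, hev⟩
    refine ⟨M, hM, ?_⟩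
    filter_upwards [hev, h3] with k hk hk3
    exact (hkey M k hk3).1 hk
  · rintro ⟨M, hM, hev⟩
    refine ⟨M, hM, ?_⟩
    filter_upwards [hev, h3] with k hk hk3
    exact (hkey M k hk3).2 hk

/-- **The `{R1♮, R2}` door on the pinned model**: `OddLogGap` and `DiagLukewarm` of `wilsonDiagonalTransferModel r sch hβ`, with the growth clause,
give the lattice statement `OddTorusSwapPairingLiminf r sch` (`core_of_logGap`, ✓p830230). -/
theorem oddTorusSwapPairingLiminf_of_transferModel_logGap (hβ : ∀ k, 0 ≤ sch.β k)
    (hR1 : OddLogGap (WilsonDiagonal.wilsonDiagonalTransferModel r sch hβ))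
    (hR2 : DiagLukewarm (WilsonDiagonal.wilsonDiagonalTransferModel r sch hβ)) (hG : Growth r sch) :
    OddTorusSwapPairingLiminf r sch :=
  core_of_logGap _ hR1 hR2 hG

end LogGap

/-! ## §2 R2♭ along sub-schemes; the `{R1, R2♭}` letters on the pinned model on every sub-scheme -/

section Tepid

variable {G : Type} [Group G] [TopologicalSpace G] [IsTopologicalGroup G] [CompactSpace G] [MeasurableSpace G] [BorelSpace G]
  {r : LatticeRep G} {sch : SpeciesScheme (YMSpecies G)}

/-- **R2♭ along `φ`**: `DiagTepid 𝔪 → DiagTepid (𝔪.restrict φ hφ)` (same `θ`; the sibling of `DiagLukewarm.restrict`). -/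
theorem DiagTepid.restrict {𝔪 : DiagonalSliceModel r sch} (h : DiagTepid 𝔪) (φ : ℕ → ℕ) (hφ : StrictMono φ) :
    DiagTepid (𝔪.restrict φ hφ) := by
  obtain ⟨θ, hθ0, hθ, hev⟩ := h
  exact ⟨θ, hθ0, hθ, fun η hη => hφ.tendsto_atTop.eventually (hev η hη)⟩

variable (r sch)

/-- **D1′'s conclusion on every sub-scheme from the `{R1, R2♭}` letters on the pinned model**: `core_of_tepid` on the restricted model
`(wilsonDiagonalTransferModel r sch hβ).restrict φ hφ`, with the sub-scheme's `Growth` discharged from D1's binders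
(`growth_subseq_of_polyRenorm_of_ufbPlanes`). -/
theorem oddTorusSwapPairingLiminf_subseq_of_transferModel_tepid (hβ : ∀ k, 0 ≤ sch.β k) (φ : ℕ → ℕ) (hφ : StrictMono φ)
    (hR1 : OddTwistGap (WilsonDiagonal.wilsonDiagonalTransferModel r sch hβ))
    (hR2 : DiagTepid (WilsonDiagonal.wilsonDiagonalTransferModel r sch hβ))
    (hc : PolyRenorm r sch) (hU : UniformFunctionalBoundPlanes r sch) (hV : PolyVolume sch) :
    OddTorusSwapPairingLiminf r (subseq sch φ hφ) :=
  core_of_tepid ((WilsonDiagonal.wilsonDiagonalTransferModel r sch hβ).restrict φ hφ) (hR1.restrict φ hφ) (hR2.restrict φ hφ)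
    (growth_subseq_of_polyRenorm_of_ufbPlanes r sch hc hU hV φ hφ)

end Tepid

/-! ## §3 The heat-trace letters R2 / R2♭ on the pinned model -/

section Heat

variable {G : Type} [Group G] [TopologicalSpace G] [IsTopologicalGroup G] [CompactSpace G] [MeasurableSpace G] [BorelSpace G]
  (r : LatticeRep G) (sch : SpeciesScheme (YMSpecies G))

omit [TopologicalSpace G] [IsTopologicalGroup G] [CompactSpace G] [MeasurableSpace G] [BorelSpace G] in
/-- **Even power sums of the padded sign sectors are even power sums of the eigenvalues**: for `t ≥ 1`,
`Σ' j (posPad emb κ j)^{2t} + Σ' j (negPad emb κ j)^{2t} = Σ' i κᵢ^{2t}` (`emb` injective, `Σ κ² < ∞`). -/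
theorem tsum_posPad_pow_add_tsum_negPad_pow {ι : Type} {emb : ι → ℕ} (he : Function.Injective emb) {κ : ι → ℝ}
    (hκ : Summable fun i => κ i ^ 2) {t : ℕ} (ht : 1 ≤ t) :
    ∑' j, WilsonDiagonal.posPad emb κ j ^ (2 * t) + ∑' j, WilsonDiagonal.negPad emb κ j ^ (2 * t) = ∑' i, κ i ^ (2 * t) := by
  have h2t : 2 * t ≠ 0 := by omega
  -- summability of `|κ|^{2t}` from `Σ κ² < ∞` (`κᵢ² ≤ T := Σ κ²`)
  set T : ℝ := ∑' i, κ i ^ 2 with hT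
  have hle : ∀ i, κ i ^ 2 ≤ T := fun i => hκ.le_tsum i fun j _ => sq_nonneg _
  have habs : Summable fun i => |κ i| ^ (2 * t) := by
    have h : ∀ i, |κ i| ^ (2 * t) = (κ i ^ 2) ^ (t - 1) * κ i ^ 2 := fun i => by
      rw [← sq_abs, ← pow_succ, ← pow_mul, Nat.sub_add_cancel ht, mul_comm]
    simp_rw [h]
    refine (hκ.mul_left (T ^ (t - 1))).of_nonneg_of_le (fun i => by positivity) fun i => ?_
    exact mul_le_mul_of_nonneg_right (pow_le_pow_left₀ (sq_nonneg _) (hle i) _) (sq_nonneg _)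
  have hp : Summable fun i => max (κ i) 0 ^ (2 * t) :=
    habs.of_nonneg_of_le (fun i => pow_nonneg (le_max_right _ _) _) fun i =>
      pow_le_pow_left₀ (le_max_right _ _) (max_le (le_abs_self _) (abs_nonneg _)) _
  have hn : Summable fun i => max (-κ i) 0 ^ (2 * t) :=
    habs.of_nonneg_of_le (fun i => pow_nonneg (le_max_right _ _) _) fun i =>
      pow_le_pow_left₀ (le_max_right _ _) (max_le (neg_le_abs _) (abs_nonneg _)) _
  rw [WilsonDiagonal.posPad, WilsonDiagonal.negPad, WilsonDiagonal.pow_extend_zero emb _ h2t, WilsonDiagonal.pow_extend_zero emb _ h2t,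
    WilsonDiagonal.tsum_extend_eq he hp, WilsonDiagonal.tsum_extend_eq he hn, ← hp.tsum_add hn]
  refine tsum_congr fun i => ?_
  have h := WilsonDiagonal.pow_eq_posPart_add_negPart (κ i) h2t
  rw [(show Even (2 * t) from ⟨t, by omega⟩).neg_one_pow, one_mul] at h
  exact h.symm

/-- **The normalised even heat trace of the pinned model at `side_k ≥ 3`, `t ≥ 1`**:
`Σ' (sp k j / top_k)^{2t} + Σ' (sm k j / top_k)^{2t} = Σ' i (κᵢ / top_k)^{2t}` over the eigen-package at `k`. -/
theorem transferModel_heatTrace_eq (hβ : ∀ k, 0 ≤ sch.β k) (k : ℕ) (h3 : 3 ≤ sch.side k) {t : ℕ} (ht : 1 ≤ t) :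
    ∑' j, ((WilsonDiagonal.wilsonDiagonalTransferModel r sch hβ).sp k j / (WilsonDiagonal.wilsonDiagonalTransferModel r sch hβ).top k) ^ (2 * t) +
        ∑' j, ((WilsonDiagonal.wilsonDiagonalTransferModel r sch hβ).sm k j / (WilsonDiagonal.wilsonDiagonalTransferModel r sch hβ).top k) ^ (2 * t) =
      ∑' i : (WilsonDiagonal.slicePkgAt r sch hβ k).s,
        ((WilsonDiagonal.slicePkgAt r sch hβ k).κ i / (WilsonDiagonal.wilsonDiagonalTransferModel r sch hβ).top k) ^ (2 * t) := by
  simp_rw [div_pow, tsum_div_const]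
  rw [← add_div, WilsonDiagonal.wilsonDiagonalTransferModel_sp r sch hβ k h3, WilsonDiagonal.wilsonDiagonalTransferModel_sm r sch hβ k h3,
    tsum_posPad_pow_add_tsum_negPad_pow (WilsonDiagonal.slicePkgAt r sch hβ k).emb_injective
      (WilsonDiagonal.slicePkgAt r sch hβ k).summable_sq ht]

/-- In the letters' range `θ · side_k ≤ t` (`θ > 0`) the exponent is positive: `1 ≤ t`. -/
theorem one_le_of_theta_mul_side_le {ι : Type} (sc : SpeciesScheme ι) {θ : ℝ} (hθ : 0 < θ) (k t : ℕ)
    (h : θ * (sc.side k : ℝ) ≤ (t : ℝ)) : 1 ≤ t := by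
  have hS : (1 : ℝ) ≤ sc.side k := by
    have : 1 ≤ sc.side k := by simp [SpeciesScheme.side]
    exact_mod_cast this
  have ht : (0 : ℝ) < t := lt_of_lt_of_le (by positivity) (le_trans (by nlinarith) h)
  have ht' : 0 < t := by exact_mod_cast ht
  omega

/-- ★ **R2 on the pinned model = a bound on the normalised even power sums of the transfer operator's eigenvalues.**
`DiagLukewarm (wilsonDiagonalTransferModel r sch hβ)` holds iff for some `0 < θ < 1/2` and `C`, eventually in `k`,
`Σ' i (κᵢ / top_k)^{2t} ≤ C` for every `t ≥ θ side_k` (the sum over the eigen-package at `k`; by `wilsonDiagonalTransferModel_evenTrace` the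
numerator is Wilson's twisted diagonal trace `Tr K_u^{2t}`). -/
theorem diagLukewarm_transferModel_iff (hβ : ∀ k, 0 ≤ sch.β k) :
    DiagLukewarm (WilsonDiagonal.wilsonDiagonalTransferModel r sch hβ) ↔
      ∃ θ : ℝ, 0 < θ ∧ θ < 1 / 2 ∧ ∃ C : ℝ, ∀ᶠ k in atTop, ∀ t : ℕ, θ * (sch.side k : ℝ) ≤ (t : ℝ) →
        ∑' i : (WilsonDiagonal.slicePkgAt r sch hβ k).s,
          ((WilsonDiagonal.slicePkgAt r sch hβ k).κ i / (WilsonDiagonal.wilsonDiagonalTransferModel r sch hβ).top k) ^ (2 * t) ≤ C := by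
  have h3 := WilsonDiagonal.eventually_three_le_side sch
  unfold DiagLukewarm
  constructor
  · rintro ⟨θ, hθ0, hθ, C, hev⟩
    refine ⟨θ, hθ0, hθ, C, ?_⟩
    filter_upwards [hev, h3] with k hk hk3 t ht
    rw [← transferModel_heatTrace_eq r sch hβ k hk3 (one_le_of_theta_mul_side_le sch hθ0 k t ht)]
    exact hk t ht
  · rintro ⟨θ, hθ0, hθ, C, hev⟩
    refine ⟨θ, hθ0, hθ, C, ?_⟩
    filter_upwards [hev, h3] with k hk hk3 t ht
    rw [transferModel_heatTrace_eq r sch hβ k hk3 (one_le_of_theta_mul_side_le sch hθ0 k t ht)]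
    exact hk t ht

/-- ★ **R2♭ on the pinned model**: `DiagTepid (wilsonDiagonalTransferModel r sch hβ)` holds iff for some `0 < θ < 1/2` and every `η > 0`,
eventually in `k`, `Σ' i (κᵢ / top_k)^{2t} ≤ exp(η a_k side_k)` for every `t ≥ θ side_k`. -/
theorem diagTepid_transferModel_iff (hβ : ∀ k, 0 ≤ sch.β k) :
    DiagTepid (WilsonDiagonal.wilsonDiagonalTransferModel r sch hβ) ↔
      ∃ θ : ℝ, 0 < θ ∧ θ < 1 / 2 ∧ ∀ η : ℝ, 0 < η → ∀ᶠ k in atTop, ∀ t : ℕ, θ * (sch.side k : ℝ) ≤ (t : ℝ) →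
        ∑' i : (WilsonDiagonal.slicePkgAt r sch hβ k).s,
          ((WilsonDiagonal.slicePkgAt r sch hβ k).κ i / (WilsonDiagonal.wilsonDiagonalTransferModel r sch hβ).top k) ^ (2 * t) ≤
          Real.exp (η * (sch.a k * sch.side k)) := by
  have h3 := WilsonDiagonal.eventually_three_le_side sch
  unfold DiagTepid
  constructor
  · rintro ⟨θ, hθ0, hθ, hev⟩
    refine ⟨θ, hθ0, hθ, fun η hη => ?_⟩
    filter_upwards [hev η hη, h3] with k hk hk3 t ht
    rw [← transferModel_heatTrace_eq r sch hβ k hk3 (one_le_of_theta_mul_side_le sch hθ0 k t ht)]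
    exact hk t ht
  · rintro ⟨θ, hθ0, hθ, hev⟩
    refine ⟨θ, hθ0, hθ, fun η hη => ?_⟩
    filter_upwards [hev η hη, h3] with k hk hk3 t ht
    rw [transferModel_heatTrace_eq r sch hβ k hk3 (one_le_of_theta_mul_side_le sch hθ0 k t ht)]
    exact hk t ht

end Heat

/-! ## §4 The even trace formula (card #110∕#121 currency) holds on the pinned model -/

section EvenTrace

variable {G : Type} [Group G] [TopologicalSpace G] [IsTopologicalGroup G] [CompactSpace G] [MeasurableSpace G] [BorelSpace G]
  {r : LatticeRep G} {sch : SpeciesScheme (YMSpecies G)}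

/-- **Even trace identities of a diagonal slice model** (`Tr A_k^{2n+2} = Σ' sp^{2n+2} + Σ' sm^{2n+2}`) — the currency predicate
`EvenTraceFormula` of cards #110∕#121 (seat «correlation-chessboard» g2, `Sketch-correlation-chessboard-g2.lean` 00ac150252e11526 :586), verbatim
with the seat's abbreviation `sliceZ ρ β n := diagCyclicTraceU ρ β (2n+2)` (the partition function `Tr K_u^{2n+2}` of the tilted torus) unfolded. -/
def EvenTraceFormula (𝔪 : DiagonalSliceModel r sch) : Prop :=
  ∀ᶠ k in atTop, ∀ n : ℕ,
    ∑' j, 𝔪.sp k j ^ (2 * n + 2) + ∑' j, 𝔪.sm k j ^ (2 * n + 2) =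
      WilsonDiagonal.diagCyclicTraceU (S := sch.side k) (G := G) r.ρ (sch.β k) (2 * n + 2)

variable (r sch)

/-- ★ **The model of record satisfies the even trace formula** (hand-2's row `wilsonDiagonalTransferModel_evenTrace`, ✓`…PinnedTrace`, at every
index with `side_k ≥ 3`, which holds eventually). -/
theorem evenTraceFormula_transferModel (hβ : ∀ k, 0 ≤ sch.β k) : EvenTraceFormula (WilsonDiagonal.wilsonDiagonalTransferModel r sch hβ) := by
  filter_upwards [WilsonDiagonal.eventually_three_le_side sch] with k hk n
  exact WilsonDiagonal.wilsonDiagonalTransferModel_evenTrace r sch hβ k hk n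

end EvenTrace

end Summit.QuantumFields.YangMills.Cruxes.DiagonalMirrorRPR.SignTwistedDiagonalTrace

end
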